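import Mathlib
import HarnessLib

/-!
# Tuza's weighted set-pair inequality

S. Jukna, *Extremal Combinatorics — with applications in computer science* (1st ed., Springer 2001)
[Jukna2001], Chapter 9 "Chains and antichains", §9.2.2 "The theorem of Bollobás", Theorem 9.9
(Tuza 1985) with the proof printed there; original: Zs. Tuza, *Critical hypergraphs and
intersecting set-pair systems*, J. Combin. Theory Ser. B 39 (1985) 134–145 [Tuza1985].

**Theorem 9.9** (Tuza 1985). Let `A_1, …, A_m` and `B_1, …, B_m` be finite sets such that
`A_i ∩ B_i = ∅` and, for all `i ≠ j`, `A_i ∩ B_j ≠ ∅` or `A_j ∩ B_i ≠ ∅`. Then for every real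
`0 < p < 1`, `Σ_i p^{|A_i|} (1 - p)^{|B_i|} ≤ 1`.

Printed proof: choose a random subset `𝐘` of the ground set `X`, each point independently with
probability `p`; the events `E_i = "A_i ⊆ 𝐘 ⊆ X - B_i"` have probability `p^{|A_i|}(1-p)^{|B_i|}`
and are pairwise disjoint. We run this as a weighted count over `Y ⊆ X` with weights
`w(Y) = p^{|Y|}(1-p)^{|X|-|Y|}` (which sum to `1` by the binomial theorem,
`Finset.sum_pow_mul_eq_add_pow`), allowing also `p ∈ {0, 1}`.

* `tuza_weighted_setPairs` — Theorem 9.9.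
-/

namespace Literature.Combinatorics.SetFamily

open Finset

variable {α : Type*} [DecidableEq α]

/-- **Theorem 9.9** (Tuza 1985). Let `(A_i, B_i)_{i ∈ ι}` be finitely many pairs of finite sets with
`A_i ∩ B_i = ∅` for all `i` and such that for all `i ≠ j` either `A_i ∩ B_j ≠ ∅` or `A_j ∩ B_i ≠ ∅`
(or both). Then for every real `p` with `0 ≤ p ≤ 1`,
`Σ_i p^{|A_i|} (1 - p)^{|B_i|} ≤ 1`. [cite: Jukna2001, Ch. 9 §9.2.2, Theorem 9.9 and its proof;
Tuza1985] -/
theorem tuza_weighted_setPairs {ι : Type*} [Fintype ι] (A B : ι → Finset α)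
    (hdisj : ∀ i, Disjoint (A i) (B i))
    (hcross : ∀ i j, i ≠ j → ¬ Disjoint (A i) (B j) ∨ ¬ Disjoint (A j) (B i))
    {p : ℝ} (hp0 : 0 ≤ p) (hp1 : p ≤ 1) :
    ∑ i, p ^ (A i).card * (1 - p) ^ (B i).card ≤ 1 := by
  classical
  -- the ground set
  set X : Finset α := univ.biUnion fun i => A i ∪ B i with hX
  have hABX : ∀ i, A i ∪ B i ⊆ X := fun i =>
    subset_biUnion_of_mem (fun i => A i ∪ B i) (mem_univ i)
  have hAX : ∀ i, A i ⊆ X := fun i => subset_union_left.trans (hABX i)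
  -- the weights `w(Y) = p^{|Y|} (1-p)^{|X|-|Y|}`, summing to `1` over `Y ⊆ X`
  set w : Finset α → ℝ := fun Y => p ^ Y.card * (1 - p) ^ (X.card - Y.card) with hw
  have hw0 : ∀ Y, 0 ≤ w Y := fun Y =>
    mul_nonneg (pow_nonneg hp0 _) (pow_nonneg (by linarith) _)
  have htotal : ∑ Y ∈ X.powerset, w Y = 1 := by
    simp only [hw]
    rw [Finset.sum_pow_mul_eq_add_pow]
    simp
  -- the events `E_i = {Y ⊆ X : A_i ⊆ Y, Y ∩ B_i = ∅}`
  set E : ι → Finset (Finset α) :=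
    fun i => X.powerset.filter fun Y => A i ⊆ Y ∧ Disjoint Y (B i) with hE
  -- `Prob(E_i) = p^{|A_i|} (1-p)^{|B_i|}`
  have hEsum : ∀ i, ∑ Y ∈ E i, w Y = p ^ (A i).card * (1 - p) ^ (B i).card := by
    intro i
    set Z := X \ (A i ∪ B i) with hZ
    have hZA : ∀ Y' ⊆ Z, Disjoint (A i) Y' := fun Y' hY'Z =>
      disjoint_left.mpr fun x hxA hxY => (mem_sdiff.mp (hY'Z hxY)).2 (mem_union_left _ hxA)
    have hEimg : E i = Z.powerset.image fun Y' => A i ∪ Y' := by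
      ext Y
      simp only [hE, mem_filter, mem_powerset, mem_image]
      constructor
      · rintro ⟨hYX, hAY, hYB⟩
        refine ⟨Y \ A i, ?_, union_sdiff_of_subset hAY⟩
        intro x hx
        rw [mem_sdiff] at hx
        rw [hZ, mem_sdiff, mem_union, not_or]
        exact ⟨hYX hx.1, hx.2, fun hxB => disjoint_left.mp hYB hx.1 hxB⟩
      · rintro ⟨Y', hY'Z, rfl⟩
        refine ⟨union_subset (hAX i) fun x hx => (mem_sdiff.mp (hY'Z hx)).1,
          subset_union_left, ?_⟩
        rw [disjoint_union_left]
        exact ⟨hdisj i, disjoint_left.mpr fun x hx hxB =>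
          (mem_sdiff.mp (hY'Z hx)).2 (mem_union_right _ hxB)⟩
    rw [hEimg, sum_image]
    · have hZcard : Z.card + ((A i).card + (B i).card) = X.card := by
        rw [hZ, card_sdiff_of_subset (hABX i), card_union_of_disjoint (hdisj i)]
        have := card_le_card (hABX i)
        rw [card_union_of_disjoint (hdisj i)] at this
        omega
      calc ∑ Y' ∈ Z.powerset, w (A i ∪ Y')
          = ∑ Y' ∈ Z.powerset, p ^ (A i).card * (1 - p) ^ (B i).card *
              (p ^ Y'.card * (1 - p) ^ (Z.card - Y'.card)) := by
            refine sum_congr rfl fun Y' hY' => ?_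
            have hY'Z : Y' ⊆ Z := mem_powerset.mp hY'
            have hc : (A i ∪ Y').card = (A i).card + Y'.card :=
              card_union_of_disjoint (hZA Y' hY'Z)
            have hle : Y'.card ≤ Z.card := card_le_card hY'Z
            simp only [hw, hc]
            rw [show X.card - ((A i).card + Y'.card) = (B i).card + (Z.card - Y'.card) by omega]
            ring
        _ = p ^ (A i).card * (1 - p) ^ (B i).card := by
            rw [← mul_sum, Finset.sum_pow_mul_eq_add_pow]
            simp
    · intro Y₁ hY₁ Y₂ hY₂ heq
      have h1 := hZA Y₁ (mem_powerset.mp hY₁)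
      have h2 := hZA Y₂ (mem_powerset.mp hY₂)
      have heq' : A i ∪ Y₁ = A i ∪ Y₂ := heq
      calc Y₁ = (A i ∪ Y₁) \ A i := (union_sdiff_cancel_left h1).symm
        _ = (A i ∪ Y₂) \ A i := by rw [heq']
        _ = Y₂ := union_sdiff_cancel_left h2
  -- the events are pairwise disjoint
  have hEdisj : ∀ i j, i ≠ j → Disjoint (E i) (E j) := by
    intro i j hij
    rw [disjoint_left]
    intro Y hYi hYj
    simp only [hE, mem_filter] at hYi hYj
    rcases hcross i j hij with h | h
    · exact h (disjoint_left.mpr fun x hxA hxB => disjoint_left.mp hYj.2.2 (hYi.2.1 hxA) hxB)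
    · exact h (disjoint_left.mpr fun x hxA hxB => disjoint_left.mp hYi.2.2 (hYj.2.1 hxA) hxB)
  -- `Σ_i Prob(E_i) = Prob(⋃ E_i) ≤ 1`
  calc ∑ i, p ^ (A i).card * (1 - p) ^ (B i).card = ∑ i, ∑ Y ∈ E i, w Y := by
        simp_rw [hEsum]
    _ = ∑ Y ∈ univ.biUnion E, w Y :=
        (sum_biUnion fun i _ j _ hij => hEdisj i j hij).symm
    _ ≤ ∑ Y ∈ X.powerset, w Y :=
        sum_le_sum_of_subset_of_nonneg (biUnion_subset.mpr fun i _ => filter_subset _ _)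
          fun Y _ _ => hw0 Y
    _ = 1 := htotal

/-- Theorem 9.9 in the printed shape, for sequences `A_1, …, A_m`, `B_1, …, B_m`.
[cite: Jukna2001, Ch. 9 §9.2.2, Theorem 9.9; Tuza1985] -/
theorem tuza_weighted_setPairs_fin (m : ℕ) (A B : Fin m → Finset α)
    (hdisj : ∀ i, Disjoint (A i) (B i))
    (hcross : ∀ i j, i ≠ j → ¬ Disjoint (A i) (B j) ∨ ¬ Disjoint (A j) (B i))
    {p : ℝ} (hp0 : 0 < p) (hp1 : p < 1) :
    ∑ i, p ^ (A i).card * (1 - p) ^ (B i).card ≤ 1 :=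
  tuza_weighted_setPairs A B hdisj hcross hp0.le hp1.le

end Literature.Combinatorics.SetFamily
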